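import Summits.QuantumFields.YangMills.Theorems.BalabanUVNodesN06SectBQLawsKnitMembers
import Literature.MathematicalPhysics.QuantumFieldTheory.Balaban1983to89.B9SectBStepUParGQOfMembers
import Literature.MathematicalPhysics.QuantumFieldTheory.Balaban1983to89.B9SectBCodedClassKnitY
import Literature.MathematicalPhysics.QuantumFieldTheory.Balaban1983to89.B9Eq3124HZKnitPairReg335YMemG
import Literature.MathematicalPhysics.QuantumFieldTheory.Balaban1983to89.B9Thm311PositivityKnitLetter
import Literature.MathematicalPhysics.QuantumFieldTheory.Balaban1983to89.B9B8KnitLetterProjectionC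

/-!
# Balaban UV-stability nodes, N06 [B9] Sect. B — «K2-G-KNIT»: THE TWO-TRANSPORTER SECT.-B STEP OVER THE CODED CARRIER AT THE KNIT TRANSPORTER
# `parA := parKnitY` AND A KNIT AVERAGING PAIR `(𝔮, 𝔮s)`, class `C37KY`, `P := extraYPb`, `𝔸 = M_N(ℂ)` — every law of the junction that the tree
# holds at the knit DISCHARGED BY NAME; displayed: the knit Thm 3.11 unit `hunitA`, the knit (3.80) variations `hQ80 ∕ hQL280`, Thm 3.2 `h32`, the coded Thm 3.3 `h33`

[B9] = T. Bałaban, *Propagators for lattice gauge theories in a background field*, Commun. Math. Phys. **99** (1985) 389–434 [`Balaban1985BackgroundPropagators`];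
[4] = [`Balaban1984PropagatorsII`]; [B8] = T. Bałaban, *Averaging operations for lattice gauge theories*, Commun. Math. Phys. **98** (1985) 17–51 [`Balaban1985Averaging`].

statement-level skeleton of published theorems with citation tags; proofs where landed; nothing here is a claim about the Yang–Mills mass gap

THE PRINT.  Thm 3.4 p. 400 (the Sect.-B step: from (3.42)–(3.48) at `U` to (3.42)–(3.47) at `U′U` for `(U, U′)` in the classes (3.35)–(3.37)); (3.19) p. 393: the averaging's
parallel transporters are those of [B8] (52)–(53) — NODE 00's KNIT transporter `parKnitY` and knit letter `QknitY`; Thms 3.1–3.3 pp. 397–399; Thm 3.11 p. 416.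

WHAT (seat dag-n06-c gen 26; the end of this seat's K2-G lane).  `B9SectBStepUParGQOfMembers.sectBStepUParGQ_parSymYH_of_members` (gen 25: the Sect.-B chain re-pressed
over a generic averaging pair, Hölder transporter `parSymY` discharged) INSTANTIATED at `parA j := parKnitY (f j).toKIdx`, `P := extraYPb`, `𝔸 := M_N(ℂ)`, the coded class
`C37 j := B9SectBCodedClassKnitY.C37KY G (f j) (ιB j) (R j) Cq CqK MK aK β₀` (gen 26), and a pair `(𝔮, 𝔮s)` that IS the knit pair (`h𝔮 ∕ h𝔮s` faces, as in gen 25's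
`…N06SectBQLawsKnitMembers`), with the following laws DISCHARGED by name:
* `hsym` := `B9B8AveragingJunction.parKnitY_inv`; `hparG` := dag-n06-l's `B9Eq3124HZKnitPairReg335YMemG.parKnitY_mem_of_reg335P` through the regime bridge `hRP` and the
  x-free numerics (`parKnitY_mem_of_reg335C` below); `hunitG` := `B9Thm311PositivityKnitLetter.isUnit_deltaPrimeAY_parKnitY`; `hunitXG` := `B9B8KnitLetterProjectionC.isUnit_XY_parKnitY`;
* `hC37 ∕ hparC ∕ hC37G` := the projections `hC37_of_C37KY ∕ hparC_of_C37KY ∕ hC37G_of_C37KY` of the knit class;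
* `hQ15 ∕ hQL2` := gen 25's `N06SectBQLawsKnitMembers.hQ15_knit ∕ hQL2_knit`;
* `hreg335P ∕ hplaq` := `B9SectBGReg335PlaqYOfClassPb.hreg335P_extraYPb` ∕ `B9SectBL2GCrossY.plaqLawY_of_reg335PlaqY` (as the (C)-road file `B9SectBStepUParHExtraYPb`);
* the Lemma-2.1 datum `(d261, h261)` := the frames' own supplier `B9SectBGpFrameCodedY.exists_d261` (n06-k's `ineq261_fn_geo9Y`), read at the frame's threshold `M261`.
DISPLAYED (the knit inputs the tree does not hold today, by name for their suppliers): `hunitA` (Thm 3.11 at `Δ_a^𝔮(U; parKnitY)`, GUARDED — dag-n06-j's knit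
family), `hQ80 ∕ hQL280` (the (3.80) variations of the pair at `C37KY` pairs — dag-n06-l's «P-Q80-knit» F3), the record's Thm 3.2 `h32`, the coded Thm 3.3 `h33`;
numerics ∕ thresholds `MInv aInv aW c₀ α₀′ hKpl hMd hMr mN hnbr`; the class constants `R Cq CqK MK aK β₀` FREE (the knit class's content — the knit (3.58), dag-n06-l's
(K1) — enters only the coded→record transfer `B9SectBCodedClassKnitY.hclass_C37KY_on`, not this step).

* §1 `norm_le_one_of_le_unitaryUnits`, ★ `parKnitY_mem_of_reg335C` (the junction's guarded `hparG` at the knit), `parMemY_parKnitY` (gen 26's displayed law `ParMemY` at the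
  knit, regularity predicate `(bg9KP M_N(ℂ) G i).Reg335 c₀`), `isUnit_deltaPrimeAY_parKnitY_of_reg335C` ∕ `isUnit_XY_parKnitY_of_reg335C` (`hunitG ∕ hunitXG`).
* §2 ★★★ `sectBStepUPar_knit_of_laws` — `SectBStepUPar extraYPb f (d+1) c35 G b parKnitY parSymY (GAQY 𝔮 𝔮s parKnitY (GpY parKnitY)) parBY C37KY C38 (CinvY … parKnitY)`.

HONEST SCOPE.  An instantiation of landed theorems; conditional on the displayed knit laws and on Thm 3.2 ∕ Thm 3.3; a HELPER toward dag-n06-d's knit certificate binder `hBK`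
(whose class must be re-keyed from `C37GY` to `C37KY` for this to be its inhabitant — n06-d's∕def-Y's call); NOT the discharge of any N06 obligation; count-neutral;
nothing about the continuum ∕ OS ∕ the Yang–Mills mass gap ∕ Clay.  Cell `pub-ymgap` (HUMAN RULING D-0062), Track A node N06 [B9], 2026-08-30.
-/

noncomputable section

namespace Summit.QuantumFields.YangMills.BalabanUVNodes.N06SectBStepUParKnit

open scoped Matrix Matrix.Norms.L2Operator
open Literature.MathematicalPhysics.QuantumFieldTheory.Balaban1983to89
open Literature.MathematicalPhysics.QuantumFieldTheory.Balaban1983to89.Node00 (SiteY BlkY FBondY IBondY CfgY SiteParY GAQY GpY XY deltaAQY deltaPrimeAY parSymY parBY)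
open Literature.MathematicalPhysics.QuantumFieldTheory.Balaban1983to89.Node00.OpsYQLetter (adjTrY)
open Literature.MathematicalPhysics.QuantumFieldTheory.Balaban1983to89.B6Ineq2142KLevelV1 (β)
open Literature.MathematicalPhysics.QuantumFieldTheory.Balaban1983to89.B6KLevelCensusIndexV1 (KIdx kGeo)
open Literature.MathematicalPhysics.QuantumFieldTheory.Balaban1983to89.B6RandomWalk (HasMajorant Ineq261)
open Literature.MathematicalPhysics.QuantumFieldTheory.Balaban1983to89.B6RandomWalkL2 (HasL2Majorant)
open Literature.MathematicalPhysics.QuantumFieldTheory.Balaban1983to89.B9Thm34Ext (toB6)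
open Literature.MathematicalPhysics.QuantumFieldTheory.Balaban1983to89.B9PinMembersKLevelV1 (MemberY geo9Y)
open Literature.MathematicalPhysics.QuantumFieldTheory.Balaban1983to89.B9BackgroundsKLevelV1P (bg9KP)
open Literature.MathematicalPhysics.QuantumFieldTheory.Balaban1983to89.B9SectBCodedClassR (RegExtraY bg9YC extraYPb)
open Literature.MathematicalPhysics.QuantumFieldTheory.Balaban1983to89.B9Eq360DeltaPrimeAY (AfldY)
open Literature.MathematicalPhysics.QuantumFieldTheory.Balaban1983to89.B9SectBGpLettersY (GVal blkC)
open Literature.MathematicalPhysics.QuantumFieldTheory.Balaban1983to89.B9SectBGpFrameCodedYR (codingYx)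
open Literature.MathematicalPhysics.QuantumFieldTheory.Balaban1983to89.B9SectBGpFrameCodedY (CplxLettersY exists_d261)
open Literature.MathematicalPhysics.QuantumFieldTheory.Balaban1983to89.B9SectBCodedReadingsUR (KACU)
open Literature.MathematicalPhysics.QuantumFieldTheory.Balaban1983to89.B9SectBCodedReadingsUParH (KSCUPar SectBStepUPar)
open Literature.MathematicalPhysics.QuantumFieldTheory.Balaban1983to89.B9SectBKerFrameCodedYR (CinvY)
open Literature.MathematicalPhysics.QuantumFieldTheory.Balaban1983to89.B9RWSumsReadsNbr (nbr)
open Literature.MathematicalPhysics.QuantumFieldTheory.Balaban1983to89.B9SectBGClassLettersY (CplxLettersGY)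
open Literature.MathematicalPhysics.QuantumFieldTheory.Balaban1983to89.B9Eq340TaxiContourLocalityY (rLB)
open Literature.MathematicalPhysics.QuantumFieldTheory.Balaban1983to89.B9SectBGReg335PlaqYOfClassPb (c335Plaq c335Plaq_nonneg hreg335P_extraYPb)
open Literature.MathematicalPhysics.QuantumFieldTheory.Balaban1983to89.B9SectBL2GCrossY (plaqLawY_of_reg335PlaqY)
open Literature.MathematicalPhysics.QuantumFieldTheory.Balaban1983to89.B9SectBGFramesSelQY (gFrame₅CodedOnSelQ)
open Literature.MathematicalPhysics.QuantumFieldTheory.Balaban1983to89.B9SectBGWordDeltaAQY (F₂QC F₂sQC)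
open Literature.MathematicalPhysics.QuantumFieldTheory.Balaban1983to89.B9SectBQLettersL2QY (F₂QC2 F₂sQC2)
open Literature.MathematicalPhysics.QuantumFieldTheory.Balaban1983to89.B9SectBStepUParGQOfMembers (sectBStepUParGQ_parSymYH_of_members)
open Literature.MathematicalPhysics.QuantumFieldTheory.Balaban1983to89.B9SectBCodedClassKnitY (C37KY ParMemY hC37_of_C37KY hparC_of_C37KY hC37G_of_C37KY)
open Literature.MathematicalPhysics.QuantumFieldTheory.Balaban1983to89.B7Prop2Explicit (unitaryUnits AvgClosed mem_unitaryUnits)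
open Literature.MathematicalPhysics.QuantumFieldTheory.Balaban1983to89.B9Eq316AveragingTransposeZd (alphaQ)
open Literature.MathematicalPhysics.QuantumFieldTheory.Balaban1983to89.B9Eq3115KnitLetterY (QknitY)
open Literature.MathematicalPhysics.QuantumFieldTheory.Balaban1983to89.B9C2FormBoxRegimeY (Kpl)
open Literature.MathematicalPhysics.QuantumFieldTheory.Balaban1983to89.B9Eq3115KnitLetterYOnto (kCol kCol_nonneg)
open Literature.MathematicalPhysics.QuantumFieldTheory.Balaban1983to89.B9B8KnitColumnFlatness (windows_of_alphaQ)
open Literature.MathematicalPhysics.QuantumFieldTheory.Balaban1983to89.B9B8AveragingJunction (parKnitY parKnitY_inv)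
open Literature.MathematicalPhysics.QuantumFieldTheory.Balaban1983to89.B9Eq3124HZKnitPairReg335YMemG (parKnitY_mem_of_reg335P)
open Literature.MathematicalPhysics.QuantumFieldTheory.Balaban1983to89.B9Thm311PositivityKnitLetter (isUnit_deltaPrimeAY_parKnitY)
open Literature.MathematicalPhysics.QuantumFieldTheory.Balaban1983to89.B9B8KnitLetterProjectionC (isUnit_XY_parKnitY)
open Summit.QuantumFields.YangMills.BalabanUVNodes.N06SectBQLawsKnitMembers (hQ15_knit hQL2_knit)

variable {d ℓ : ℕ} {hd : 1 ≤ d + 1} {hL : Odd (ℓ + 1) ∧ 1 < ℓ + 1} {b₀ b₁ : ℝ}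
variable {N : ℕ} [Nonempty (Fin N)] {ι : Type} [Fintype ι] [DecidableEq ι]
variable {Mstar : ℕ} {J : Type} (f : J → MemberY d ℓ hd hL b₀ b₁ Mstar)
  [∀ x : MemberY d ℓ hd hL b₀ b₁ Mstar, Fintype (geo9Y x).Site]
  [instDS : ∀ x : MemberY d ℓ hd hL b₀ b₁ Mstar, DecidableEq (geo9Y x).Site] [instNE : ∀ x : MemberY d ℓ hd hL b₀ b₁ Mstar, Nonempty (geo9Y x).Site]
  (c35 : ℝ) (G : Subgroup (Matrix (Fin N) (Fin N) ℂ)ˣ)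
  (𝔮 : ∀ j : J, CfgY (Matrix (Fin N) (Fin N) ℂ) (f j).toKIdx → ((FBondY (f j).toKIdx → Matrix (Fin N) (Fin N) ℂ) →ₗ[ℂ] (IBondY (f j).toKIdx → Matrix (Fin N) (Fin N) ℂ)))
  (𝔮s : ∀ j : J, CfgY (Matrix (Fin N) (Fin N) ℂ) (f j).toKIdx → ((IBondY (f j).toKIdx → Matrix (Fin N) (Fin N) ℂ) →ₗ[ℂ] (FBondY (f j).toKIdx → Matrix (Fin N) (Fin N) ℂ)))
  (b : Module.Basis ι ℝ (Matrix (Fin N) (Fin N) ℂ)) (ιB : ∀ j : J, BlkY (f j).toKIdx → IBondY (f j).toKIdx)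
  (C38 : ∀ j : J, ℝ → CfgY (Matrix (Fin N) (Fin N) ℂ) (f j).toKIdx → AfldY (Matrix (Fin N) (Fin N) ℂ) (f j).toKIdx → Prop)
  (R : ∀ j : J, ℝ → CfgY (Matrix (Fin N) (Fin N) ℂ) (f j).toKIdx → Prop) (Cq CqK MK aK β₀ : ℝ)

/-! ## §1 The averaging-transporter laws of the junction at the knit, from the landed knit lemmas -/

section ParLaws

omit [Fintype ι] [DecidableEq ι] in
/-- a subgroup of the unitary group consists of contractions (`‖u‖ = 1`). [cite: Balaban1985BackgroundPropagators, (3.3) p.391, bookkeeping] -/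
theorem norm_le_one_of_le_unitaryUnits (hGU : G ≤ unitaryUnits (Matrix (Fin N) (Fin N) ℂ)) :
    ∀ u : (Matrix (Fin N) (Fin N) ℂ)ˣ, u ∈ G → ‖(u : Matrix (Fin N) (Fin N) ℂ)‖ ≤ 1 :=
  fun _ hu => (CStarRing.norm_of_mem_unitary (mem_unitaryUnits.1 (hGU hu))).le

variable {MInv aInv : ℝ} {c₀ α₀' : ℝ}

omit [Fintype ι] [DecidableEq ι] [∀ x : MemberY d ℓ hd hL b₀ b₁ Mstar, Fintype (geo9Y x).Site] instDS instNE in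
/-- ★ **THE JUNCTION's GUARDED MEMBERSHIP LAW `hparG` AT `parA := parKnitY`**: above `M_inv ≦ M`, at a (3.35)-regular base of the coded class (bridged by `hRP` to the local
class `(bg9KP M_N(ℂ) G i).Reg335 c₀`, `c₀ ≦ 10`) with `M·α₀ ≦ a_inv` inside the knit numerics window (`α₀′ ≦ α_Q`, `K_pl(a)·L⁴ < α₀′` for `a ≦ a_inv`), the whole knit
table `parKnitY U` is `G`-valued, `G` averaging-closed in `U(N)` — dag-n06-l's `parKnitY_mem_of_reg335P`.
[cite: Balaban1985BackgroundPropagators, (3.19) p.393, (3.35) p.396; Balaban1985Averaging, Prop. 2 p.26, (52)–(53) p.27] -/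
theorem parKnitY_mem_of_reg335C (P : RegExtraY d ℓ hd hL b₀ b₁ Mstar (Matrix (Fin N) (Fin N) ℂ))
    (hGa : AvgClosed (d + 1) (ℓ + 1) G) (hGU : G ≤ unitaryUnits (Matrix (Fin N) (Fin N) ℂ))
    (hMInv : 0 < MInv) (hc : c₀ ≤ 10)
    (hRP : ∀ (j : J) (α₀ : ℝ) (U : CfgY (Matrix (Fin N) (Fin N) ℂ) (f j).toKIdx),
      (bg9YC (Matrix (Fin N) (Fin N) ℂ) G P (f j)).Reg335 c35 α₀ U → (bg9KP (Matrix (Fin N) (Fin N) ℂ) G (f j).toKIdx).Reg335 c₀ α₀ U)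
    (hα' : 0 < α₀') (hαQ : α₀' ≤ alphaQ (d + 1) (ℓ + 1))
    (hKpl : ∀ (j : J) (a : ℝ), 0 ≤ a → a ≤ aInv → Kpl (f j).toKIdx a * (kGeo (f j).toKIdx).L ^ 4 < α₀') :
    ∀ j (α₀ : ℝ) (U : CfgY (Matrix (Fin N) (Fin N) ℂ) (f j).toKIdx), MInv ≤ (geo9Y (f j)).M → 0 < α₀ → (geo9Y (f j)).M * α₀ ≤ aInv →
      (bg9YC (Matrix (Fin N) (Fin N) ℂ) G P (f j)).Reg335 c35 α₀ U → ∀ z w : SiteY (f j).toKIdx, parKnitY (f j).toKIdx U z w ∈ G := by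
  intro j α₀ U hM hα₀ hMa hU z w
  have hMx : 0 ≤ (geo9Y (f j)).M := hMInv.le.trans hM
  have hMα : 0 ≤ (kGeo (f j).toKIdx).M * α₀ := mul_nonneg hMx hα₀.le
  obtain ⟨hα3, hα2, -⟩ := windows_of_alphaQ (D := d + 1) hL.2 (Nat.succ_pos d) hα' hαQ
  exact parKnitY_mem_of_reg335P (f j).toKIdx hGa (norm_le_one_of_le_unitaryUnits G hGU) U hc hMα (hRP j α₀ U hU) hα' hα3 hα2
    (hKpl j _ hMα hMa) z w

omit [Fintype ι] [DecidableEq ι] instDS instNE in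
/-- **THE DISPLAYED MEMBERSHIP LAW `ParMemY` OF THE KNIT CLASS FILE, INHABITED AT THE KNIT** for the regularity predicate `(bg9KP M_N(ℂ) G i).Reg335 c₀` at one index above
`0 ≦ M` (one of the two laws `B9SectBCodedClassKnitY.hclass_C37KY_at` asks; the other — the knit (3.58), `ParVar337Y` — is dag-n06-l's (K1)).
[cite: Balaban1985BackgroundPropagators, (3.19) p.393, (3.35) p.396; Balaban1985Averaging, Prop. 2 p.26] -/
theorem parMemY_parKnitY (i : KIdx d ℓ hd hL b₀ b₁) (hGa : AvgClosed (d + 1) (ℓ + 1) G) (hGU : G ≤ unitaryUnits (Matrix (Fin N) (Fin N) ℂ))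
    (hM : 0 ≤ (kGeo i).M) (hc : c₀ ≤ 10) (hα' : 0 < α₀') (hαQ : α₀' ≤ alphaQ (d + 1) (ℓ + 1))
    (hKpl : ∀ a : ℝ, 0 ≤ a → a ≤ aInv → Kpl i a * (kGeo i).L ^ 4 < α₀') :
    ParMemY G i (parKnitY i) (fun α₀ U => (bg9KP (Matrix (Fin N) (Fin N) ℂ) G i).Reg335 c₀ α₀ U) aInv := by
  intro α₀ U hα₀ hMa hreg z w
  have hMα : 0 ≤ (kGeo i).M * α₀ := mul_nonneg hM hα₀.le
  obtain ⟨hα3, hα2, -⟩ := windows_of_alphaQ (D := d + 1) hL.2 (Nat.succ_pos d) hα' hαQ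
  exact parKnitY_mem_of_reg335P i hGa (norm_le_one_of_le_unitaryUnits G hGU) U hc hMα hreg hα' hα3 hα2 (hKpl _ hMα hMa) z w

omit [Fintype ι] [DecidableEq ι] [∀ x : MemberY d ℓ hd hL b₀ b₁ Mstar, Fintype (geo9Y x).Site] instDS instNE in
/-- ★ **THE JUNCTION's GUARDED `hunitG` AT THE KNIT**: `Δ′_a(U; parKnitY)` is a unit at the regular bases above the thresholds (Thm 3.11's «obvious» positivity,
`isUnit_deltaPrimeAY_parKnitY`, fed by `parKnitY_mem_of_reg335C`). [cite: Balaban1985BackgroundPropagators, (3.24) p.394, Thm 3.11 p.416, (3.35) p.396] -/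
theorem isUnit_deltaPrimeAY_parKnitY_of_reg335C (P : RegExtraY d ℓ hd hL b₀ b₁ Mstar (Matrix (Fin N) (Fin N) ℂ))
    (hGa : AvgClosed (d + 1) (ℓ + 1) G) (hGU : G ≤ unitaryUnits (Matrix (Fin N) (Fin N) ℂ))
    (hMInv : 0 < MInv) (hc : c₀ ≤ 10)
    (hRP : ∀ (j : J) (α₀ : ℝ) (U : CfgY (Matrix (Fin N) (Fin N) ℂ) (f j).toKIdx),
      (bg9YC (Matrix (Fin N) (Fin N) ℂ) G P (f j)).Reg335 c35 α₀ U → (bg9KP (Matrix (Fin N) (Fin N) ℂ) G (f j).toKIdx).Reg335 c₀ α₀ U)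
    (hα' : 0 < α₀') (hαQ : α₀' ≤ alphaQ (d + 1) (ℓ + 1))
    (hKpl : ∀ (j : J) (a : ℝ), 0 ≤ a → a ≤ aInv → Kpl (f j).toKIdx a * (kGeo (f j).toKIdx).L ^ 4 < α₀') :
    ∀ j (α₀ : ℝ) (U : CfgY (Matrix (Fin N) (Fin N) ℂ) (f j).toKIdx), MInv ≤ (geo9Y (f j)).M → 0 < α₀ → (geo9Y (f j)).M * α₀ ≤ aInv →
      (bg9YC (Matrix (Fin N) (Fin N) ℂ) G P (f j)).Reg335 c35 α₀ U → IsUnit (deltaPrimeAY (f j).toKIdx (parKnitY (f j).toKIdx) U) :=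
  fun j α₀ U hM hα₀ hMa hU =>
    isUnit_deltaPrimeAY_parKnitY (f j).toKIdx hGU hU.1.1 (parKnitY_mem_of_reg335C f c35 G P hGa hGU hMInv hc hRP hα' hαQ hKpl j α₀ U hM hα₀ hMa hU)

omit [Fintype ι] [DecidableEq ι] [∀ x : MemberY d ℓ hd hL b₀ b₁ Mstar, Fintype (geo9Y x).Site] instDS instNE in
/-- ★ **THE JUNCTION's GUARDED `hunitXG` AT THE KNIT**: `Q′G′²Q′*(U; parKnitY)` is a unit at the regular bases above the thresholds (`isUnit_XY_parKnitY`).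
[cite: Balaban1985BackgroundPropagators, p.395, Thm 3.11 p.416, (3.35) p.396] -/
theorem isUnit_XY_parKnitY_of_reg335C (P : RegExtraY d ℓ hd hL b₀ b₁ Mstar (Matrix (Fin N) (Fin N) ℂ))
    (hGa : AvgClosed (d + 1) (ℓ + 1) G) (hGU : G ≤ unitaryUnits (Matrix (Fin N) (Fin N) ℂ))
    (hMInv : 0 < MInv) (hc : c₀ ≤ 10)
    (hRP : ∀ (j : J) (α₀ : ℝ) (U : CfgY (Matrix (Fin N) (Fin N) ℂ) (f j).toKIdx),
      (bg9YC (Matrix (Fin N) (Fin N) ℂ) G P (f j)).Reg335 c35 α₀ U → (bg9KP (Matrix (Fin N) (Fin N) ℂ) G (f j).toKIdx).Reg335 c₀ α₀ U)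
    (hα' : 0 < α₀') (hαQ : α₀' ≤ alphaQ (d + 1) (ℓ + 1))
    (hKpl : ∀ (j : J) (a : ℝ), 0 ≤ a → a ≤ aInv → Kpl (f j).toKIdx a * (kGeo (f j).toKIdx).L ^ 4 < α₀') :
    ∀ j (α₀ : ℝ) (U : CfgY (Matrix (Fin N) (Fin N) ℂ) (f j).toKIdx), MInv ≤ (geo9Y (f j)).M → 0 < α₀ → (geo9Y (f j)).M * α₀ ≤ aInv →
      (bg9YC (Matrix (Fin N) (Fin N) ℂ) G P (f j)).Reg335 c35 α₀ U →
      IsUnit (XY (f j).toKIdx (parKnitY (f j).toKIdx) (GpY (f j).toKIdx (parKnitY (f j).toKIdx)) U) :=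
  fun j α₀ U hM hα₀ hMa hU =>
    isUnit_XY_parKnitY (f j).toKIdx hGU hU.1.1 (parKnitY_mem_of_reg335C f c35 G P hGa hGU hMInv hc hRP hα' hαQ hKpl j α₀ U hM hα₀ hMa hU)

end ParLaws

/-! ## §2 ★★★ The Sect.-B step at the knit transporter, the class `C37KY`, `P := extraYPb` -/

section Knit

/-- ★★★ **THE TWO-TRANSPORTER SECT.-B STEP OVER THE CODED CARRIER AT THE KNIT TRANSPORTER `parKnitY`, THE KNIT CLASS `C37KY`, `P := extraYPb`, `𝔸 = M_N(ℂ)`** — gen 25's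
`sectBStepUParGQ_parSymYH_of_members` with `hsym ∕ hparG ∕ hunitG ∕ hunitXG` (knit lemmas), `hC37 ∕ hparC ∕ hC37G` (projections of `C37KY`), `hQ15 ∕ hQL2` (`hQ15_knit ∕ hQL2_knit`,
constants `κQ ∕ κQ2` of that file), `hreg335P ∕ hplaq` (`extraYPb`) and the Lemma-2.1 datum (`exists_d261` at the frame's own threshold) DISCHARGED.  DISPLAYED: `hι`, `hGa hGU`,
the basis data `M₂ hrepr hcR hcL`, the knit faces `h𝔮 h𝔮s`, the numerics window `MInv aInv aW c₀ α₀′` (`hMInv haInv haW hc hRP hα' hαQ hKpl hMd hMr mN hnbr`), the class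
constants `R Cq CqK MK aK β₀` (`hCqK`), the GUARDED knit Thm 3.11 unit `hunitA`, `hb₁`, the knit (3.80) variations `hQ80 ∕ hQL280` (constants `cF ∕ cF2`) at the class
`C37KY`, the record's Thm 3.2 `h32` and the coded Thm 3.3 `h33`.
[cite: Balaban1985BackgroundPropagators, Thm 3.4 p.400, Sect. B pp.400–407, (3.19) p.393, (3.21) p.394, (3.35)–(3.37) p.396, (3.40) p.397, Thms 3.1–3.3 pp.397–399, Thm 3.11 p.416; Balaban1985Averaging, Prop. 2 p.26; Balaban1984PropagatorsII, Lemma 2.1 p.234, (2.51) p.232] -/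
theorem sectBStepUPar_knit_of_laws [NormOneClass (Matrix (Fin N) (Fin N) ℂ)] [FiniteDimensional ℝ (Matrix (Fin N) (Fin N) ℂ)]
    (hι : ∀ (j : J) (s : BlkY (f j).toKIdx), β (f j).toKIdx.hN (f j).toKIdx.D (f j).toKIdx.hk (ιB j s) = s)
    (hGa : AvgClosed (d + 1) (ℓ + 1) G) (hGU : G ≤ unitaryUnits (Matrix (Fin N) (Fin N) ℂ))
    (M₂ : ℝ) (hM₂ : 0 ≤ M₂) (hrepr : ∀ (v : Matrix (Fin N) (Fin N) ℂ) (j : ι), |b.repr v j| ≤ M₂ * ‖v‖) (hcR : 0 < M₂ * ∑ j, ‖b j‖)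
    (hcL : 0 < Real.sqrt (Fintype.card ι) * M₂ * ∑ j, ‖b j‖)
    (h𝔮 : ∀ (j : J) (U : CfgY (Matrix (Fin N) (Fin N) ℂ) (f j).toKIdx), 𝔮 j U = QknitY (f j).toKIdx U)
    (h𝔮s : ∀ (j : J) (U : CfgY (Matrix (Fin N) (Fin N) ℂ) (f j).toKIdx), 𝔮s j U = adjTrY (QknitY (f j).toKIdx U))
    (hCqK : 0 ≤ CqK)
    (MInv aInv aW : ℝ) (hMInv : 0 < MInv) (haInv : 0 < aInv) (haW : 0 < aW) {c₀ : ℝ} (hc : c₀ ≤ 10)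
    (hRP : ∀ (j : J) (α₀ : ℝ) (U : CfgY (Matrix (Fin N) (Fin N) ℂ) (f j).toKIdx),
      (bg9YC (Matrix (Fin N) (Fin N) ℂ) G (extraYPb (Matrix (Fin N) (Fin N) ℂ) G) (f j)).Reg335 c35 α₀ U →
        (bg9KP (Matrix (Fin N) (Fin N) ℂ) G (f j).toKIdx).Reg335 c₀ α₀ U)
    {α₀' : ℝ} (hα' : 0 < α₀') (hαQ : α₀' ≤ alphaQ (d + 1) (ℓ + 1))
    (hKpl : ∀ (j : J) (a : ℝ), 0 ≤ a → a ≤ aInv → Kpl (f j).toKIdx a * (kGeo (f j).toKIdx).L ^ 4 < α₀')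
    (hunitA : ∀ j (α₀ : ℝ) (U : CfgY (Matrix (Fin N) (Fin N) ℂ) (f j).toKIdx), MInv ≤ (geo9Y (f j)).M → 0 < α₀ → (geo9Y (f j)).M * α₀ ≤ aInv →
      (bg9YC (Matrix (Fin N) (Fin N) ℂ) G (extraYPb (Matrix (Fin N) (Fin N) ℂ) G) (f j)).Reg335 c35 α₀ U →
      IsUnit (deltaAQY (f j).toKIdx (𝔮 j) (𝔮s j) (parKnitY (f j).toKIdx) (GpY (f j).toKIdx (parKnitY (f j).toKIdx)) U)) (hb₁ : 0 ≤ b₁)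
    (cF : ℝ) (hcF : 0 ≤ cF)
    (hQ80 : ∀ j (β' : ℝ) (U : CfgY (Matrix (Fin N) (Fin N) ℂ) (f j).toKIdx) (a : AfldY (Matrix (Fin N) (Fin N) ℂ) (f j).toKIdx), 0 < β' →
      C37KY G (f j) (ιB j) (R j) Cq CqK MK aK β₀ β' U a → ∀ δ : ℝ, 0 < δ → δ ≤ 1 →
      HasMajorant (g := toB6 (geo9Y (f j)) 0 True) (fun q : (Fin (d + 1) × SiteY (f j).toKIdx) × ι => blkC (f j).toKIdx (ιB j) q.1.2)
          (F₂QC (f j).toKIdx (𝔮 j) b (.base U) (.mult a)) (fun a₁ a₂ => cF * β' * Real.exp (-(δ * (geo9Y (f j)).dist a₁ a₂))) ∧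
        HasMajorant (g := toB6 (geo9Y (f j)) 0 True) (fun q : (Fin (d + 1) × SiteY (f j).toKIdx) × ι => blkC (f j).toKIdx (ιB j) q.1.2)
          (F₂sQC (f j).toKIdx (𝔮s j) b (.base U) (.mult a)) (fun a₁ a₂ => cF * β' * Real.exp (-(δ * (geo9Y (f j)).dist a₁ a₂))))
    (cF2 : ℝ) (hcF2 : 0 ≤ cF2)
    (hQL280 : ∀ j (β' : ℝ) (U : CfgY (Matrix (Fin N) (Fin N) ℂ) (f j).toKIdx) (a : AfldY (Matrix (Fin N) (Fin N) ℂ) (f j).toKIdx), 0 < β' →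
      C37KY G (f j) (ιB j) (R j) Cq CqK MK aK β₀ β' U a → ∀ δ : ℝ, 0 < δ → δ ≤ 1 →
      HasL2Majorant (g := toB6 (geo9Y (f j)) 0 True) (fun q : (Fin (d + 1) × SiteY (f j).toKIdx) × ι => blkC (f j).toKIdx (ιB j) q.1.2)
          (F₂QC2 (f j).toKIdx (𝔮 j) b (.base U) (.mult a)) (fun a₁ a₂ => cF2 * β' * Real.exp (-(δ * (geo9Y (f j)).dist a₁ a₂))) ∧
        HasL2Majorant (g := toB6 (geo9Y (f j)) 0 True) (fun q : (Fin (d + 1) × SiteY (f j).toKIdx) × ι => blkC (f j).toKIdx (ιB j) q.1.2)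
          (F₂sQC2 (f j).toKIdx (𝔮s j) b (.base U) (.mult a)) (fun a₁ a₂ => cF2 * β' * Real.exp (-(δ * (geo9Y (f j)).dist a₁ a₂))))
    (hMd : 2 * ((d : ℝ) + 1) < MInv) (mN : ℕ) (hnbr : ∀ (j : J) (y' : IBondY (f j).toKIdx), (nbr (geo9Y (f j)) (2 * ((d : ℝ) + 1)) y').card ≤ mN)
    (hMr : rLB d ℓ + 1 < MInv)
    (h32 : B9.Thm32Printed (d + 1) c35 (fun j => geo9Y (f j)) (fun j => bg9YC (Matrix (Fin N) (Fin N) ℂ) G (extraYPb (Matrix (Fin N) (Fin N) ℂ) G) (f j))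
      (CinvY (extraYPb (Matrix (Fin N) (Fin N) ℂ) G) f G (fun j => parKnitY (f j).toKIdx)))
    (h33 : B9.Thm33Printed c35 (fun j => geo9Y (f j))
      (fun j => (codingYx (extraYPb (Matrix (Fin N) (Fin N) ℂ) G) G (f j) (C37KY G (f j) (ιB j) (R j) Cq CqK MK aK β₀) (C38 j)).bg)
      (fun j => KSCUPar (extraYPb (Matrix (Fin N) (Fin N) ℂ) G) G (f j) (parKnitY (f j).toKIdx) (parSymY (f j).toKIdx)
        (C37KY G (f j) (ιB j) (R j) Cq CqK MK aK β₀) (C38 j))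
      (fun j => KACU (extraYPb (Matrix (Fin N) (Fin N) ℂ) G) G (f j)
        (GAQY (f j).toKIdx (𝔮 j) (𝔮s j) (parKnitY (f j).toKIdx) (GpY (f j).toKIdx (parKnitY (f j).toKIdx))) (parBY (f j).toKIdx)
        (C37KY G (f j) (ιB j) (R j) Cq CqK MK aK β₀) (C38 j))) :
    SectBStepUPar (extraYPb (Matrix (Fin N) (Fin N) ℂ) G) f (d + 1) c35 G b (fun j => parKnitY (f j).toKIdx) (fun j => parSymY (f j).toKIdx)
      (fun j => GAQY (f j).toKIdx (𝔮 j) (𝔮s j) (parKnitY (f j).toKIdx) (GpY (f j).toKIdx (parKnitY (f j).toKIdx)))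
      (fun j => parBY (f j).toKIdx) (fun j => C37KY G (f j) (ιB j) (R j) Cq CqK MK aK β₀) C38
      (CinvY (extraYPb (Matrix (Fin N) (Fin N) ℂ) G) f G (fun j => parKnitY (f j).toKIdx)) := by
  have hG1 := norm_le_one_of_le_unitaryUnits G hGU
  have hparG := parKnitY_mem_of_reg335C f c35 G (extraYPb (Matrix (Fin N) (Fin N) ℂ) G) hGa hGU hMInv hc hRP hα' hαQ hKpl
  have hunitG := isUnit_deltaPrimeAY_parKnitY_of_reg335C f c35 G (extraYPb (Matrix (Fin N) (Fin N) ℂ) G) hGa hGU hMInv hc hRP hα' hαQ hKpl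
  have hunitXG := isUnit_XY_parKnitY_of_reg335C f c35 G (extraYPb (Matrix (Fin N) (Fin N) ℂ) G) hGa hGU hMInv hc hRP hα' hαQ hKpl
  have hQ15 := hQ15_knit (Mstar := Mstar) (extraYPb (Matrix (Fin N) (Fin N) ℂ) G) f c35 G 𝔮 𝔮s b ιB hGU hι hM₂ hrepr h𝔮 h𝔮s hMInv hc hRP hα' hαQ hKpl
  have hQL2 := hQL2_knit (Mstar := Mstar) (extraYPb (Matrix (Fin N) (Fin N) ℂ) G) f c35 G 𝔮 𝔮s b ιB hGU hι hM₂ hrepr h𝔮 h𝔮s hMInv hc hRP hα' hαQ hKpl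
  have hκQ : 0 ≤ (M₂ * ∑ j, ‖b j‖) * ((N : ℝ) ^ 4 * ((1 + 2 * ((d : ℝ) + 1)) * (1 + kCol (d + 1) (ℓ + 1) * α₀' * (2 * ((d : ℝ) + 1)))) *
      Real.exp ((ℓ : ℝ) + 4)) := by
    have := kCol_nonneg (d + 1) (ℓ + 1)
    have hb : 0 ≤ ∑ j, ‖b j‖ := Finset.sum_nonneg fun _ _ => norm_nonneg _
    positivity
  have hκQ2 : 0 ≤ (Real.sqrt (Fintype.card ι) * M₂ * ∑ j, ‖b j‖) *
      (1 * Real.sqrt (((N : ℝ) ^ 4 * ((1 + 2 * ((d : ℝ) + 1)) * (1 + kCol (d + 1) (ℓ + 1) * α₀' * (2 * ((d : ℝ) + 1))))) *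
        ((N : ℝ) ^ 4 * ((1 + 2 * ((d : ℝ) + 1)) * (1 + kCol (d + 1) (ℓ + 1) * α₀' * (2 * ((d : ℝ) + 1))))))) *
      Real.exp ((ℓ : ℝ) + 4) := by
    have hb : 0 ≤ ∑ j, ‖b j‖ := Finset.sum_nonneg fun _ _ => norm_nonneg _
    positivity
  exact sectBStepUParGQ_parSymYH_of_members (extraYPb (Matrix (Fin N) (Fin N) ℂ) G) f c35 G 𝔮 𝔮s b ιB C38 (fun j => parKnitY (f j).toKIdx)
    (fun j => C37KY G (f j) (ιB j) (R j) Cq CqK MK aK β₀) hι hG1 M₂ hM₂ hrepr hcR hcL CqK hCqK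
    (fun j => hC37_of_C37KY G (f j) (ιB j) (R j)) MInv aInv aW hMInv haInv haW hparG (fun j => hparC_of_C37KY G (f j) (ιB j) (R j)) hunitG hunitXG
    (fun j U z w => parKnitY_inv (f j).toKIdx U z w) hunitA hb₁ (c335Plaq ℓ aInv) (c335Plaq_nonneg ℓ haInv.le)
    (hreg335P_extraYPb G f ιB hι hMd aInv c35) (fun j => hC37G_of_C37KY G (f j) (ιB j) (R j)) _ hκQ hQ15 cF hcF hQ80 _ hκQ2 hQL2 cF2 hcF2 hQL280
    hMd mN hnbr hMr (cP := 2 * c335Plaq ℓ aInv) (mul_nonneg zero_le_two (c335Plaq_nonneg ℓ haInv.le))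
    (fun j α₀ U hM hα hMa hU => plaqLawY_of_reg335PlaqY G (f j) (ιB j) hG1 hU.1.1 (c335Plaq_nonneg ℓ haInv.le)
      (hreg335P_extraYPb G f ιB hι hMd aInv c35 j α₀ U hM hα hMa hU))
    (Classical.choose (exists_d261 (d := d) (ℓ := ℓ) (hd := hd) (hL := hL) (b₀ := b₀) (b₁ := b₁) (Mstar := Mstar)))
    (fun j δ α hδ _ hα hα1 hM => Classical.choose_spec (Classical.choose_spec
      (exists_d261 (d := d) (ℓ := ℓ) (hd := hd) (hL := hL) (b₀ := b₀) (b₁ := b₁) (Mstar := Mstar))) (f j) δ α hδ hα hα1.le hM)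
    h32 h33

end Knit

end Summit.QuantumFields.YangMills.BalabanUVNodes.N06SectBStepUParKnit

end
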